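import Summits.CriticalPhenomena.PercolationContinuityZ3.Theorems.Transplant.TwoAxisParaCells
import Summits.CriticalPhenomena.PercolationContinuityZ3.Theorems.Transplant.SkelPhiEquilibriumDefs
import HarnessLib

/-!
# N1 ({±1} node) file (C-2b) (hp-8 g31): the COARSE SKELETON `Skelφ.coarseSkel` at V-level — bridge from `TwoAxis.Para` (p266166) to p3-g8's
# `Skelφ.shearCoord` (SkelPhiEquilibriumDefs, p265235): `λ₁ = A·β′`, the 1-Lipschitz property of `ρ ∘ (φ − φ t)`, and COARSE CONTAINMENT
# (planar boxes of side `s` about a vertex lie in coarse boxes of side `k` once `c·L_i·s ≤ k·D`) — NEG-NODE-F-SCOPE §12 (s2)–(s4)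

builds on p205010 (kernel theorem, internal audit signed; external expert review pending) — nothing in this file uses p205010.
Lane `prim-bschramm`, seat `prim-hp-8` (gen 31); helper file (`--supports stmt-CriticalPhenomena-4575 --as helper`).
* `TwoAxis.Para.abs_coarse_sub_le` (general resolution: `|t − t'| ≤ L`, `c·L ≤ k·D` ⇒ `|ρ t − ρ t'| ≤ k`);
* `Skelφ.relφ φ t w := φ w − φ t` (as a `Site 2`), `Skelφ.lam1_relφ_eq_shearCoord` (**`λ₁ = A·β′`**), `Skelφ.coarseSkel`, `Skelφ.lip_relφ`, **`Skelφ.lip_coarseSkel`**;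
* **`Skelφ.coarse_containment`**: `|φ w i − φ w' i| ≤ s` (both `i`) and `c·L_i·s ≤ k·D` ⇒ `|coarseSkel w i − coarseSkel w' i| ≤ k`.
[cite: MartineauTassion2017, §4.3] [cite: KozmaNitzan2024, §4 Lemma 10 Step IV]
-/

namespace Summit.CriticalPhenomena.PercolationContinuityZ3.Theorems.Transplant

open Literature.Probability.LatticeModels

namespace TwoAxis.Para

/-- **Coarse coordinates at resolution `k`**: `|t − t'| ≤ L` and `c·L ≤ k·D` give `|ρ t − ρ t'| ≤ k` (`0 ≤ c`, `0 < D`). [folklore] -/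
theorem abs_coarse_sub_le {c s D L t t' k : ℤ} (hc : 0 ≤ c) (hD : 0 < D) (hL : c * L ≤ k * D) (h : |t - t'| ≤ L) :
    |coarse c s D t - coarse c s D t'| ≤ k := by
  have hct : |c * t - c * t'| ≤ k * D := by
    rw [← mul_sub, abs_mul, abs_of_nonneg hc]
    exact (mul_le_mul_of_nonneg_left h hc).trans hL
  rw [abs_le] at hct ⊢
  unfold coarse
  constructor
  · have h1 : c * t' + s ≤ c * t + s + k * D := by linarith [hct.1]
    have h2 := Int.ediv_le_ediv hD h1
    rw [Int.add_mul_ediv_right _ _ hD.ne'] at h2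
    linarith
  · have h1 : c * t + s ≤ c * t' + s + k * D := by linarith [hct.2]
    have h2 := Int.ediv_le_ediv hD h1
    rw [Int.add_mul_ediv_right _ _ hD.ne'] at h2
    linarith

end TwoAxis.Para

namespace Skelφ

variable {V : Type} {G : SimpleGraph V} {φ : V → Site 2}

/-- The planar position relative to a base vertex, as a `Site 2`. [folklore] -/
def relφ (φ : V → Site 2) (t : V) (w : V) : Site 2 := fun i => φ w i - φ t i

/-- `relφ` unfolded. [folklore] -/
@[simp] theorem relφ_apply (φ : V → Site 2) (t w : V) (i : Fin 2) : relφ φ t w i = φ w i - φ t i := rfl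

/-- **`λ₁ = A·β′`**: the second dual coordinate of the relative position is `A` times p3-g8's sheared coordinate. [this work] -/
theorem lam1_relφ_eq_shearCoord (A : ℤ) (n : ℕ) (h : ℤ) (t w : V) :
    TwoAxis.Para.lam1 A n h (relφ φ t w) = A * shearCoord φ t n h w := by
  simp [TwoAxis.Para.lam1, TwoAxis.Para.bp, relφ, shearCoord_apply]

/-- The relative position is 1-Lipschitz when `φ` is. [folklore] -/
theorem lip_relφ (hlip : Lip G φ) (t : V) : Lip G (relφ φ t) := by
  intro u v huv i
  simpa [relφ] using hlip huv i

/-- **The coarse skeleton** of the cell lattice `[A·u A·v]` about the base vertex `t`: `w ↦ (⌊(c·λ₀ + s₀)/D⌋, ⌊(c·λ₁ + s₁)/D⌋)` of the relative position. [this work] -/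
def coarseSkel (φ : V → Site 2) (t : V) (A n h vα vβ c s₀ s₁ D : ℤ) : V → Site 2 := fun w =>
  ![TwoAxis.Para.coarse c s₀ D (TwoAxis.Para.lam0 A vα vβ (relφ φ t w)), TwoAxis.Para.coarse c s₁ D (TwoAxis.Para.lam1 A n h (relφ φ t w))]

/-- **The coarse skeleton is 1-Lipschitz** (so `PlanarCells2*` and every `hlip`-only region file apply to it verbatim). [cite: MartineauTassion2017, §4.3] -/
theorem lip_coarseSkel (hlip : Lip G φ) (t : V) {A n h vα vβ c s₀ s₁ D : ℤ} (hc : 0 ≤ c) (hD : 0 < D)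
    (hL0 : c * (|A| * (|vβ| + |vα|)) ≤ D) (hL1 : c * (|A| * (|n| + |h|)) ≤ D) :
    Lip G (coarseSkel φ t A n h vα vβ c s₀ s₁ D) :=
  TwoAxis.Para.lip_coarse_comp (lip_relφ hlip t) hc hD hL0 hL1

/-- **COARSE CONTAINMENT**: two vertices whose planar positions differ by at most `s` in each coordinate have coarse positions differing by at most
`k` in each coordinate, as soon as `c·L_i·s ≤ k·D` (`L₀ = |A|(|vβ|+|vα|)`, `L₁ = |A|(|n|+|h|)`) — a φ-square / φ-parallelogram of planar size `s`
about a kit centre lies in the coarse box of side `k` about its coarse position. [cite: KozmaNitzan2024, §4 Lemma 10 Step IV] -/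
theorem coarse_containment (t : V) {A n h vα vβ c s₀ s₁ D s k : ℤ} (hc : 0 ≤ c) (hD : 0 < D)
    (hL0 : c * (|A| * (|vβ| + |vα|) * s) ≤ k * D) (hL1 : c * (|A| * (|n| + |h|) * s) ≤ k * D)
    {w w' : V} (h0 : |φ w 0 - φ w' 0| ≤ s) (h1 : |φ w 1 - φ w' 1| ≤ s) (i : Fin 2) :
    |coarseSkel φ t A n h vα vβ c s₀ s₁ D w i - coarseSkel φ t A n h vα vβ c s₀ s₁ D w' i| ≤ k := by
  -- planar Lipschitz bounds scaled by `s`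
  have hl0 : |TwoAxis.Para.lam0 A vα vβ (relφ φ t w) - TwoAxis.Para.lam0 A vα vβ (relφ φ t w')| ≤ |A| * (|vβ| + |vα|) * s := by
    have e : TwoAxis.Para.lam0 A vα vβ (relφ φ t w) - TwoAxis.Para.lam0 A vα vβ (relφ φ t w') =
        A * (vβ * (φ w 0 - φ w' 0) - vα * (φ w 1 - φ w' 1)) := by
      simp only [TwoAxis.Para.lam0, relφ_apply]; ring
    rw [e, abs_mul]
    calc |A| * |vβ * (φ w 0 - φ w' 0) - vα * (φ w 1 - φ w' 1)|
        ≤ |A| * (|vβ| * s + |vα| * s) := by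
          refine mul_le_mul_of_nonneg_left ?_ (abs_nonneg A)
          calc |vβ * (φ w 0 - φ w' 0) - vα * (φ w 1 - φ w' 1)| ≤ |vβ * (φ w 0 - φ w' 0)| + |vα * (φ w 1 - φ w' 1)| := abs_sub _ _
            _ = |vβ| * |φ w 0 - φ w' 0| + |vα| * |φ w 1 - φ w' 1| := by rw [abs_mul, abs_mul]
            _ ≤ |vβ| * s + |vα| * s := by gcongr
      _ = |A| * (|vβ| + |vα|) * s := by ring
  have hl1 : |TwoAxis.Para.lam1 A n h (relφ φ t w) - TwoAxis.Para.lam1 A n h (relφ φ t w')| ≤ |A| * (|n| + |h|) * s := by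
    have e : TwoAxis.Para.lam1 A n h (relφ φ t w) - TwoAxis.Para.lam1 A n h (relφ φ t w') =
        A * (n * (φ w 1 - φ w' 1) - h * (φ w 0 - φ w' 0)) := by
      simp only [TwoAxis.Para.lam1, TwoAxis.Para.bp, relφ_apply]; ring
    rw [e, abs_mul]
    calc |A| * |n * (φ w 1 - φ w' 1) - h * (φ w 0 - φ w' 0)|
        ≤ |A| * (|n| * s + |h| * s) := by
          refine mul_le_mul_of_nonneg_left ?_ (abs_nonneg A)
          calc |n * (φ w 1 - φ w' 1) - h * (φ w 0 - φ w' 0)| ≤ |n * (φ w 1 - φ w' 1)| + |h * (φ w 0 - φ w' 0)| := abs_sub _ _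
            _ = |n| * |φ w 1 - φ w' 1| + |h| * |φ w 0 - φ w' 0| := by rw [abs_mul, abs_mul]
            _ ≤ |n| * s + |h| * s := by gcongr
      _ = |A| * (|n| + |h|) * s := by ring
  fin_cases i
  · exact TwoAxis.Para.abs_coarse_sub_le hc hD hL0 hl0
  · exact TwoAxis.Para.abs_coarse_sub_le hc hD hL1 hl1

end Skelφ

end Summit.CriticalPhenomena.PercolationContinuityZ3.Theorems.Transplant
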